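import Summits.QuantumFields.YangMills.Theorems.UnitScaleTiltProp7Row79AtMemberT3
import Summits.QuantumFields.YangMills.Theorems.UnitScaleTiltProp7SectET3RealityPInvJTermT3
import HarnessLib

/-!
# Route `UnitScaleTilt`, crux «MinimiserStabilityRegPr» (stmt-QuantumFields-19200, stub EX `stub_existenceMinimalOrbit`, route (α)) — «H79-MEMBER» PINV TWIN: **THE ROW (r79) OF THE LATTICE
# (84) AT THE T³ MEMBER, AT THE PINV LETTERS OF THE EX DISPLAY OF RECORD S9′** (✓`Prop7StubEXOfChartPiecesTwS9P`: `Δ₁ := DeltaOnePJ`, `Δ_π := DeltaPiSlotP`, `H := H46P`; ★★OWNER RULING g28-№4 (C2′)) —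
# [Balaban1985Variational] (78)–(79) ∕ [Balaban1985BackgroundPropagators] (3.127)–(3.128) in the currency of lit `B11Eq81ExpansionZpow.hasDerivAt_actionZ_chartRay_real`'s hypothesis `h79`

Cell `ym3-torus` (HUMAN RULING D-0037, YM ladder rung R3 — YM₃ on T³, NOT d = 4, NOT Clay; YM gap NOT proved), width seat `ym3-torus-px21` gen 2 (explicit-unit helper; lineage `hCrit93′`);
EX namer ★`ym-ust-19200-w2` g6 2026-08-28T20:48:46Z «`h79`-member at `DeltaOneJᴾ`».  Twin of ✓`Prop7Row79AtMember` (today's S9-descent letters) over the pinv letters ✓`…SectET3DeltaOneT3PInv` (P0′,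
`DeltaOnePJ`, `tjFormP`, `tjSesqP`), ✓`…SectET3DeltaOneT3PInvGlue` (ym3-torus-px16: `inner_DeltaOnePJ`, `tjSesqP_apply`, `tjFormP_apply`), ✓`…SectET3RealityPInvJTermT3` (ym3-torus-px3 (P3):
`tjFormP_star`, `tjSesqP_conj_symm`), ✓`Prop7Row74AtMember` (`gaugeCorrP_eq_self_of_landau`, `inner_DeltaPiP_of_landau`); the slot-free §1 of ✓`Prop7Row79AtMember` (`quadPart_Ctilde_eq`,
`tjForm_rows_of_regPr`) is imported, not repeated.  THEOREMS ONLY (0 `def`, 0 `sorry`); `--supports stmt-QuantumFields-19200 --as helper`, count-neutral; NO claim on crux ∕ stub ∕ registry.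

WHAT IS PROVED (member `F`, `K n`, `h : n ≤ K`, `0 ≤ a`; `U₀ ∈ 𝔘_k(ε₀)` with `10⁹L²e ≤ 1`, `10¹²L³ε₀ ≤ 1`; ns `…Theorems.Prop7Row79AtMemberPInv`):
* §1 `smul_iota_H1f_eq_H46P_smul` — the (W-X′) units identity at the pinv slot: `κ_f • ι(H1f …Δ_πᴾ… U₀ X′) = H46P U₀ (I • X′)` (✓`iota_H1f_eq`, ✓`Hf_apply`, as (G22)).
* §2 ★`tjFormP_self_real_of_star_eq`, ★★`inner_DeltaOnePJ_sub_inner_DeltaPiP_of_landau` (`⟪v, Δ₁ᴾv⟫ − ⟪v, Δ_πᴾv⟫ = tjSesqP v v` on Landau `v`), ★`pair27_Jcur_iota_H1fP_eq`.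
* §3 ★★★**`pair27_DeltaOnePJ_eq_of_landau`** — (r79) at the member, pinv letters, for Landau Hermitian `ιY`; member text ★★`h79_member_DeltaOnePJ : ∀ Y, (IsLandauPrintS … ιY ∧ ∀ b, star (ιY b) = ιY b) → …`
  = lit's `h79` with `P Y := Landau ∧ Hermitian`, `Δ₁ := currentCLM … (DeltaOnePJ … U₀)`, `Δπ := currentCLM … (DeltaPiSlotP … U₀)`, `H := H1f …Δ_πᴾ… U₀`, `C := C̃`, `J := Jcur (bgOfCfg F K U₀)`.
HONEST SCOPE.  Linear algebra + the calculus of ✓`Prop7Row79AtMember` §1 over landed letters; regime `U₀ ∈ 𝔘_k(ε₀)` + windows + `0 ≤ a` displayed; no estimate; not a proof of any stub;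
nothing continuum ∕ OS ∕ mass-gap ∕ Clay.

References: T. Bałaban, CMP **102** (1985) 277–309 [Balaban1985Variational] ((44)–(46) p.285, (56) p.286, (78)–(79), (84) p.290); CMP **99** (1985) 389–434 [Balaban1985BackgroundPropagators]
((3.11)–(3.14) pp.392–393, (3.119) p.419, (3.126)–(3.128) pp.420–421).
-/

set_option autoImplicit false

noncomputable section

open scoped InnerProductSpace ComplexConjugate Matrix.Norms.L2Operator BigOperators Topology
open Complex (I)
open Filter Metric

namespace Summit.QuantumFields.YangMills.Theorems.Prop7Row79AtMemberPInv

open Literature.MathematicalPhysics.QuantumFieldTheory.Balaban1983to89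
open Literature.MathematicalPhysics.QuantumFieldTheory.Balaban1983to89.T3ContinuumYM3Torus
open T3SectALandauChart (eta eta_pos)
open T3PrintedRegularMinimiser (RegPr)
open B9SectCLatticeCarrier (Bond)
open B11Eq115Space (NegSize Space115 JetSup NegSup)
open B11Eq111FrakG (nabla115)
open B11Eq103H1Complex (SiteL2K BondL2K funEquiv)
open B11Eq98CurrentSlot (Jcur)
open B11Eq90Transpose (pair27)
open B11Eq90V0primeCurrent (flat115 flat115_apply)
open B11Eq80Current (quadPart)
open B9Eq3119DeltaPiCarrier (currentCLM)
open Summit.QuantumFields.YangMills.Theorems.Prop7SectET3Transport (periodsT3 bondEquiv bgOfCfg)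
open Summit.QuantumFields.YangMills.Theorems.Prop7SectET3HilbertLetters (W₂ frobEquiv toL2 DL2 DstarL2)
open Summit.QuantumFields.YangMills.Theorems.Prop7SectET3GaugeProjector (NS RS)
open Summit.QuantumFields.YangMills.Theorems.Prop7SectET3CurvedPropagators (H1f HT Hf_apply iota_H1f_eq)
open Summit.QuantumFields.YangMills.Theorems.Prop7SectET3DeltaPiPInv (gaugeCorrP DeltaPiP DeltaPiSlotP H46P DeltaPiSlotP_apply)
open Summit.QuantumFields.YangMills.Theorems.Prop7SectET3DeltaOne (actionGrad avgHess avgHess_def)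
open Summit.QuantumFields.YangMills.Theorems.Prop7SectET3DeltaOnePInv (tjFormP tjSesqP TJP TJSlotP DeltaOnePJ tjFormP_apply tjSesqP_apply inner_DeltaOnePJ)
open Summit.QuantumFields.YangMills.Theorems.Prop7SectET3RealityPInvJTerm (tjFormP_star tjSesqP_conj_symm)
open Summit.QuantumFields.YangMills.Theorems.Prop7SymAvgTwSym (logChartTwS QTwS CmapTwS)
open Summit.QuantumFields.YangMills.Theorems.Prop7SPrint (IsLandauPrintS isLandauPrintS_iff_RS)
open Summit.QuantumFields.YangMills.Theorems.Prop7SectET3WilsonHessian (DeltaEta)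
open Summit.QuantumFields.YangMills.Theorems.Prop7Crit93OfEq111 (pair27_eq_inner_toL2 toL2_currentCLM funEquiv_symm_eq_toL2')
open Summit.QuantumFields.YangMills.Theorems.Prop7ActionGradCurrent (actionGrad_eq_inner_toL2_Jcur)
open Summit.QuantumFields.YangMills.Theorems.Prop7Row74AtMember (gaugeCorrP_eq_self_of_landau inner_DeltaPiP_of_landau)
open Summit.QuantumFields.YangMills.Theorems.Prop7Row79AtMember (quadPart_Ctilde_eq tjForm_rows_of_regPr)

variable {F : T3Family} {n K : ℕ} {h : n ≤ K} {c₀ cB a : ℝ} [Fact (0 < c₀)] [Fact (0 < cB)]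
variable [Fact (0 < (F.L : ℝ))] [Fact (0 < ((F.L : ℝ)⁻¹) ^ (K - n))]

/-! ## §1 The (W-X′) units identity at the pinv slot -/

/-- **`κ_f • ι(H1f …Δ_πᴾ… U₀ X′) = H46P U₀ (I • X′)`** — the A-units (115)-letter `H₁f` at the pinv slot and the exponent-units route letter `H46P = η • toL2⁻¹∘HT∘toL2B` read the same `H(U₀)`
(twin of ✓`Prop7SectET3WChartConj.smul_iota_H1f_eq_H46_smul`). [cite: Balaban1985Variational, (45)–(46) p.285, (103) p.293; Balaban1985BackgroundPropagators, (3.126) p.420] -/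
theorem smul_iota_H1f_eq_H46P_smul (U₀ : GaugeField (F.P K) 0 (Matrix.specialUnitaryGroup (Fin 2) ℂ)) (X' : PBond (F.P n) 0 → Matrix (Fin 2) (Fin 2) ℂ) :
    ((((eta F n K : ℝ) : ℂ)) * Complex.I) • (fun b : PBond (F.P K) 0 => JetSup.equiv _ _ _ (H1f F n K h c₀ cB a (DeltaPiSlotP F n K h c₀ cB a) U₀ X') (bondEquiv F K b))
      = H46P F n K h c₀ cB a U₀ (Complex.I • X') := by
  rw [iota_H1f_eq, H46P, map_smul, Hf_apply, smul_smul, mul_comm]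

/-! ## §2 PINV letters: `t_Jᴾ` real on Hermitian fields, `⟪v, Δ₁ᴾv⟫ − ⟪v, Δ_πᴾv⟫` on the Landau subspace, the `J`-pairing of an `H̃ᴾ`-image -/

/-- ★ **`t_J[X, X]` IS REAL ON HERMITIAN `X`** at `U₀ ∈ 𝔘_k(ε₀)` (✓`tjForm_star`: `t_J[Xᴴ, Yᴴ] = conj t_J[X, Y]`). [cite: Balaban1985BackgroundPropagators, (3.127) p.421; Balaban1985Variational, (51) p.286] -/
theorem tjFormP_self_real_of_star_eq (ha : 0 ≤ a) {ε₀ e : ℝ} (hε₀ : 0 < ε₀) (he : 0 < e) (hWe : 10 ^ 9 * (F.L : ℝ) ^ 2 * e ≤ 1) (hWε : 10 ^ 12 * (F.L : ℝ) ^ 3 * ε₀ ≤ 1)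
    (U₀ : GaugeField (F.P K) 0 (Matrix.specialUnitaryGroup (Fin 2) ℂ)) (hreg : RegPr F n K ε₀ U₀) {X : PBond (F.P K) 0 → Matrix (Fin 2) (Fin 2) ℂ} (hX : star X = X) :
    conj (tjFormP F n K h c₀ cB a U₀ X X) = tjFormP F n K h c₀ cB a U₀ X X := by
  obtain ⟨hQ, hAs, hAr, hAc⟩ := tjForm_rows_of_regPr (h := h) hε₀ he hWe hWε U₀ hreg
  rw [← tjFormP_star U₀ ha hQ hAs hAr hAc, hX]

/-- ★★ **`⟪v, Δ₁ v⟫ − ⟪v, Δ_π v⟫ = tjSesq v v` ON THE LANDAU SUBSPACE** (`P v = v`; `T_J` conjugate-symmetric at `𝔘_k(ε₀)`): (79)∕(3.127)–(3.128) read as «`Δ₁ − Δ_π` is the J-term».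
[cite: Balaban1985Variational, (79) p.290; Balaban1985BackgroundPropagators, (3.119) p.419, (3.127)–(3.128) p.421] -/
theorem inner_DeltaOnePJ_sub_inner_DeltaPiP_of_landau (ha : 0 ≤ a) {ε₀ e : ℝ} (hε₀ : 0 < ε₀) (he : 0 < e) (hWe : 10 ^ 9 * (F.L : ℝ) ^ 2 * e ≤ 1) (hWε : 10 ^ 12 * (F.L : ℝ) ^ 3 * ε₀ ≤ 1)
    (U₀ : GaugeField (F.P K) 0 (Matrix.specialUnitaryGroup (Fin 2) ℂ)) (hreg : RegPr F n K ε₀ U₀) {v : BondL2K ℂ 3 (periodsT3 F K) c₀ W₂}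
    (hv : RS F n K h c₀ cB U₀ (DstarL2 F n K c₀ U₀ v) = 0) :
    ⟪v, DeltaOnePJ F n K h c₀ cB a U₀ v⟫_ℂ - ⟪v, DeltaPiSlotP F n K h c₀ cB a U₀ v⟫_ℂ = tjSesqP F n K h c₀ cB a U₀ v v := by
  obtain ⟨hQ, hAs, hAr, hAc⟩ := tjForm_rows_of_regPr (h := h) hε₀ he hWe hWε U₀ hreg
  rw [inner_DeltaOnePJ, DeltaPiSlotP_apply, inner_DeltaPiP_of_landau U₀ hv hv, gaugeCorrP_eq_self_of_landau U₀ hv, tjSesqP_conj_symm U₀ ha hQ hAs hAr hAc, add_sub_cancel_left]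

/-- ★ **THE `J`-PAIRING OF AN `H̃`-IMAGE**: `κ_f · pair27 tr J (flat115 (H̃ X′)) = 2I · actionGrad U₀ (H46 U₀ (I • X′))` — (27) in `L²` letters (✓`pair27_eq_inner_toL2`, ✓`actionGrad_eq_inner_toL2_Jcur`) and the
units identity `κ_f • ι(H̃ X′) = H46 (I • X′)` (✓`smul_iota_H1f_eq_H46_smul`). [cite: Balaban1985Variational, (27) p.282, (45)–(46) p.285, (78) p.290; Balaban1985BackgroundPropagators, (3.11) p.392, (3.126) p.420] -/
theorem pair27_Jcur_iota_H1fP_eq (U₀ : GaugeField (F.P K) 0 (Matrix.specialUnitaryGroup (Fin 2) ℂ)) (X' : PBond (F.P n) 0 → Matrix (Fin 2) (Fin 2) ℂ) :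
    ((((eta F n K : ℝ) : ℂ)) * Complex.I) *
        pair27 (LinearMap.toContinuousLinearMap (Matrix.traceLinearMap (Fin 2) ℂ ℂ))
          (Jcur (bgOfCfg F K U₀) : NegSize (F.L : ℝ) (((F.L : ℝ)⁻¹) ^ (K - n)) (fun _ : Bond 3 (periodsT3 F K) => K - n) 3 (Matrix (Fin 2) (Fin 2) ℂ))
          (flat115 (H1f F n K h c₀ cB a (DeltaPiSlotP F n K h c₀ cB a) U₀ X'))
      = 2 * Complex.I * actionGrad F K U₀ (H46P F n K h c₀ cB a U₀ (Complex.I • X')) := by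
  have hη : ((((F.L : ℝ)⁻¹) ^ (K - n) : ℝ) : ℂ) = (((eta F n K : ℝ) : ℂ)) := rfl
  have hη0 : (((eta F n K : ℝ) : ℂ)) ≠ 0 := Complex.ofReal_ne_zero.2 (eta_pos F n K).ne'
  have hc : (c₀ : ℂ) ≠ 0 := Complex.ofReal_ne_zero.2 (Fact.out : 0 < c₀).ne'
  have hflat : (fun b : PBond (F.P K) 0 => flat115 (H1f F n K h c₀ cB a (DeltaPiSlotP F n K h c₀ cB a) U₀ X') (bondEquiv F K b))
      = fun b : PBond (F.P K) 0 => JetSup.equiv _ _ _ (H1f F n K h c₀ cB a (DeltaPiSlotP F n K h c₀ cB a) U₀ X') (bondEquiv F K b) := rfl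
  -- the pairing in `L²` letters and the gradient in `L²` letters share the inner product `X := ⟪toL2 (ιH̃X′)ᴴ, Ĵ⟫`
  have hP := pair27_eq_inner_toL2 (c₀ := c₀) (Jcur (bgOfCfg F K U₀) : NegSize (F.L : ℝ) (((F.L : ℝ)⁻¹) ^ (K - n)) (fun _ : Bond 3 (periodsT3 F K) => K - n) 3 (Matrix (Fin 2) (Fin 2) ℂ))
    (flat115 (H1f F n K h c₀ cB a (DeltaPiSlotP F n K h c₀ cB a) U₀ X'))
  rw [hflat, hη] at hP
  -- the gradient along `κ_f • ι(H̃X′) = H46 (I • X′)`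
  have hG := actionGrad_eq_inner_toL2_Jcur (n := n) (c₀ := c₀) U₀ (((((eta F n K : ℝ) : ℂ)) * Complex.I) •
    fun b : PBond (F.P K) 0 => JetSup.equiv _ _ _ (H1f F n K h c₀ cB a (DeltaPiSlotP F n K h c₀ cB a) U₀ X') (bondEquiv F K b))
  rw [star_smul, LinearEquiv.map_smul, inner_smul_left, starRingEnd_apply, star_star, smul_iota_H1f_eq_H46P_smul, funEquiv_symm_eq_toL2', hη] at hG
  rw [hP, hG]
  have hI : Complex.I * Complex.I = -1 := Complex.I_mul_I
  linear_combination (Complex.I * (((eta F n K : ℝ) : ℂ)) ^ 4 * (c₀ : ℂ)⁻¹ *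
    ⟪toL2 F K c₀ (star fun b : PBond (F.P K) 0 => JetSup.equiv _ _ _ (H1f F n K h c₀ cB a (DeltaPiSlotP F n K h c₀ cB a) U₀ X') (bondEquiv F K b)),
      toL2 F K c₀ (fun b : PBond (F.P K) 0 => NegSup.equiv _ _
        (Jcur (bgOfCfg F K U₀) : NegSize (F.L : ℝ) (((F.L : ℝ)⁻¹) ^ (K - n)) (fun _ : Bond 3 (periodsT3 F K) => K - n) 3 (Matrix (Fin 2) (Fin 2) ℂ)) (bondEquiv F K b))⟫_ℂ) * hI

/-! ## §3 ★★★ The row (r79) of the lattice (84) at the member — PINV letters of the display of record S9′ -/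

/-- ★★★ **(r79) AT THE MEMBER**: for `U₀ ∈ 𝔘_k(ε₀)` in the windows and a (115)-field `Y` whose exponent reading `ιY` is Hermitian and Landau,
`pair27 tr (Δ̂₁ Y) (flat115 Y) = pair27 tr (Δ̂_π Y) (flat115 Y) − 2·pair27 tr J (flat115 (H̃ (C̃⁽²⁾(Y))))` with `Δ̂₁ := currentCLM … (DeltaOneJ … U₀)`, `Δ̂_π := currentCLM … (DeltaPiSlot … U₀)`,
`J := Jcur (bgOfCfg F K U₀)`, `H̃ := H1f …Δ_π… U₀`, `C̃ := (−I)•CmapTwS U₀ (κ_f • ι·)` — print's (79) «Δ₁ = Δ_π − Δ_π⁽²⁾, ½⟨A′, Δ_π⁽²⁾A′⟩ = ⟨HC⁽²⁾(A′), J⟩» at the tree's letters.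
[cite: Balaban1985Variational, (78)–(79) p.290, (84) p.290; Balaban1985BackgroundPropagators, (3.127)–(3.128) p.421, (3.119) p.419] -/
theorem pair27_DeltaOnePJ_eq_of_landau (ha : 0 ≤ a) {ε₀ e : ℝ} (hε₀ : 0 < ε₀) (he : 0 < e) (hWe : 10 ^ 9 * (F.L : ℝ) ^ 2 * e ≤ 1) (hWε : 10 ^ 12 * (F.L : ℝ) ^ 3 * ε₀ ≤ 1)
    (U₀ : GaugeField (F.P K) 0 (Matrix.specialUnitaryGroup (Fin 2) ℂ)) (hreg : RegPr F n K ε₀ U₀)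
    (Y : Space115 (F.L : ℝ) (((F.L : ℝ)⁻¹) ^ (K - n)) (fun _ : Bond 3 (periodsT3 F K) => K - n) (fun _ : Bond 3 (periodsT3 F K) × Fin 3 => K - n)
      (nabla115 (((F.L : ℝ)⁻¹) ^ (K - n)) (bgOfCfg F K U₀)))
    (hR : ∀ b : PBond (F.P K) 0, star (JetSup.equiv _ _ _ Y (bondEquiv F K b)) = JetSup.equiv _ _ _ Y (bondEquiv F K b))
    (hL : IsLandauPrintS F n K h c₀ cB U₀ (fun b : PBond (F.P K) 0 => JetSup.equiv _ _ _ Y (bondEquiv F K b))) :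
    pair27 (LinearMap.toContinuousLinearMap (Matrix.traceLinearMap (Fin 2) ℂ ℂ))
        (currentCLM frobEquiv (fun _ : Bond 3 (periodsT3 F K) × Fin 3 => K - n) (nabla115 (((F.L : ℝ)⁻¹) ^ (K - n)) (bgOfCfg F K U₀)) (DeltaOnePJ F n K h c₀ cB a U₀) Y)
        (flat115 Y)
      = pair27 (LinearMap.toContinuousLinearMap (Matrix.traceLinearMap (Fin 2) ℂ ℂ))
          (currentCLM frobEquiv (fun _ : Bond 3 (periodsT3 F K) × Fin 3 => K - n) (nabla115 (((F.L : ℝ)⁻¹) ^ (K - n)) (bgOfCfg F K U₀)) (DeltaPiSlotP F n K h c₀ cB a U₀) Y)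
          (flat115 Y)
        - 2 * pair27 (LinearMap.toContinuousLinearMap (Matrix.traceLinearMap (Fin 2) ℂ ℂ))
          (Jcur (bgOfCfg F K U₀) : NegSize (F.L : ℝ) (((F.L : ℝ)⁻¹) ^ (K - n)) (fun _ : Bond 3 (periodsT3 F K) => K - n) 3 (Matrix (Fin 2) (Fin 2) ℂ))
          (flat115 (H1f F n K h c₀ cB a (DeltaPiSlotP F n K h c₀ cB a) U₀
            (quadPart (fun A' : Space115 (F.L : ℝ) (((F.L : ℝ)⁻¹) ^ (K - n)) (fun _ : Bond 3 (periodsT3 F K) => K - n)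
                (fun _ : Bond 3 (periodsT3 F K) × Fin 3 => K - n) (nabla115 (((F.L : ℝ)⁻¹) ^ (K - n)) (bgOfCfg F K U₀)) =>
                  (-Complex.I) • CmapTwS F n K h U₀ (((((eta F n K : ℝ) : ℂ)) * Complex.I) • fun b : PBond (F.P K) 0 => JetSup.equiv _ _ _ A' (bondEquiv F K b))) Y))) := by
  have hη : ((((F.L : ℝ)⁻¹) ^ (K - n) : ℝ) : ℂ) = (((eta F n K : ℝ) : ℂ)) := rfl
  have hη0 : (((eta F n K : ℝ) : ℂ)) ≠ 0 := Complex.ofReal_ne_zero.2 (eta_pos F n K).ne'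
  have hc : (c₀ : ℂ) ≠ 0 := Complex.ofReal_ne_zero.2 (Fact.out : 0 < c₀).ne'
  have hI : Complex.I * Complex.I = -1 := Complex.I_mul_I
  have hstar : star (fun b : PBond (F.P K) 0 => JetSup.equiv _ _ _ Y (bondEquiv F K b)) = fun b : PBond (F.P K) 0 => JetSup.equiv _ _ _ Y (bondEquiv F K b) := funext hR
  have hv : RS F n K h c₀ cB U₀ (DstarL2 F n K c₀ U₀ (toL2 F K c₀ (fun b : PBond (F.P K) 0 => JetSup.equiv _ _ _ Y (bondEquiv F K b)))) = 0 := (isLandauPrintS_iff_RS U₀ _).1 hL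
  -- the quadratic letter `C̃⁽²⁾(Y) = (Iη²∕2)•avgHess ιY ιY` and the `J`-pairing of its `H̃`-image: `= η·t_J[ιY, ιY]`
  have hT' : actionGrad F K U₀ (H46P F n K h c₀ cB a U₀ (avgHess F n K h U₀ (fun b : PBond (F.P K) 0 => JetSup.equiv _ _ _ Y (bondEquiv F K b))
      (fun b : PBond (F.P K) 0 => JetSup.equiv _ _ _ Y (bondEquiv F K b))))
      = -tjFormP F n K h c₀ cB a U₀ (fun b : PBond (F.P K) 0 => JetSup.equiv _ _ _ Y (bondEquiv F K b)) (fun b : PBond (F.P K) 0 => JetSup.equiv _ _ _ Y (bondEquiv F K b)) := by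
    rw [tjFormP_apply, neg_neg]
  rw [quadPart_Ctilde_eq (h := h) hε₀ he hWe hWε U₀ hreg Y]
  have hJ := pair27_Jcur_iota_H1fP_eq (h := h) (c₀ := c₀) (cB := cB) (a := a) U₀ (((Complex.I * (((eta F n K : ℝ) : ℂ)) ^ 2) / 2) •
    avgHess F n K h U₀ (fun b : PBond (F.P K) 0 => JetSup.equiv _ _ _ Y (bondEquiv F K b)) (fun b : PBond (F.P K) 0 => JetSup.equiv _ _ _ Y (bondEquiv F K b)))
  have hJ2 : 2 * Complex.I * actionGrad F K U₀ (H46P F n K h c₀ cB a U₀ (Complex.I • (((Complex.I * (((eta F n K : ℝ) : ℂ)) ^ 2) / 2) •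
      avgHess F n K h U₀ (fun b : PBond (F.P K) 0 => JetSup.equiv _ _ _ Y (bondEquiv F K b)) (fun b : PBond (F.P K) 0 => JetSup.equiv _ _ _ Y (bondEquiv F K b)))))
      = 2 * Complex.I * ((Complex.I * ((Complex.I * (((eta F n K : ℝ) : ℂ)) ^ 2) / 2)) *
          -tjFormP F n K h c₀ cB a U₀ (fun b : PBond (F.P K) 0 => JetSup.equiv _ _ _ Y (bondEquiv F K b)) (fun b : PBond (F.P K) 0 => JetSup.equiv _ _ _ Y (bondEquiv F K b))) := by
    rw [smul_smul, map_smul, map_smul, smul_eq_mul, hT']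
  have hP2 : pair27 (LinearMap.toContinuousLinearMap (Matrix.traceLinearMap (Fin 2) ℂ ℂ))
      (Jcur (bgOfCfg F K U₀) : NegSize (F.L : ℝ) (((F.L : ℝ)⁻¹) ^ (K - n)) (fun _ : Bond 3 (periodsT3 F K) => K - n) 3 (Matrix (Fin 2) (Fin 2) ℂ))
      (flat115 (H1f F n K h c₀ cB a (DeltaPiSlotP F n K h c₀ cB a) U₀ ((((Complex.I * (((eta F n K : ℝ) : ℂ)) ^ 2) / 2) •
        avgHess F n K h U₀ (fun b : PBond (F.P K) 0 => JetSup.equiv _ _ _ Y (bondEquiv F K b)) (fun b : PBond (F.P K) 0 => JetSup.equiv _ _ _ Y (bondEquiv F K b))))))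
      = (((eta F n K : ℝ) : ℂ)) * tjFormP F n K h c₀ cB a U₀ (fun b : PBond (F.P K) 0 => JetSup.equiv _ _ _ Y (bondEquiv F K b)) (fun b : PBond (F.P K) 0 => JetSup.equiv _ _ _ Y (bondEquiv F K b)) := by
    have hκ : (((eta F n K : ℝ) : ℂ)) * Complex.I ≠ 0 := mul_ne_zero hη0 Complex.I_ne_zero
    refine mul_left_cancel₀ hκ ?_
    rw [hJ, hJ2]
    linear_combination (-((((eta F n K : ℝ) : ℂ)) ^ 2) * Complex.I *
      tjFormP F n K h c₀ cB a U₀ (fun b : PBond (F.P K) 0 => JetSup.equiv _ _ _ Y (bondEquiv F K b)) (fun b : PBond (F.P K) 0 => JetSup.equiv _ _ _ Y (bondEquiv F K b))) * hI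
  rw [hP2]
  -- the two Hessian pairings in `L²` letters; `⟪v, Δ₁v⟫ − ⟪v, Δ_πv⟫ = tjSesq v v = (−2c₀∕η²)·t_J[ιY, ιY]`
  have hS : tjSesqP F n K h c₀ cB a U₀ (toL2 F K c₀ (fun b : PBond (F.P K) 0 => JetSup.equiv _ _ _ Y (bondEquiv F K b)))
      (toL2 F K c₀ (fun b : PBond (F.P K) 0 => JetSup.equiv _ _ _ Y (bondEquiv F K b)))
      = ((-(2 * (c₀ : ℂ)) / (((eta F n K : ℝ) : ℂ)) ^ 2)) *
          tjFormP F n K h c₀ cB a U₀ (fun b : PBond (F.P K) 0 => JetSup.equiv _ _ _ Y (bondEquiv F K b)) (fun b : PBond (F.P K) 0 => JetSup.equiv _ _ _ Y (bondEquiv F K b)) := by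
    rw [tjSesqP_apply, LinearEquiv.symm_apply_apply, hstar]
  have h1 := inner_DeltaOnePJ_sub_inner_DeltaPiP_of_landau ha hε₀ he hWe hWε U₀ hreg hv
  rw [hS] at h1
  simp only [pair27_eq_inner_toL2 (c₀ := c₀), toL2_currentCLM, flat115_apply, hstar, hη]
  rw [eq_add_of_sub_eq h1]  -- `⟪v, Δ₁v⟫ = (−2c₀∕η²)·t_J + ⟪v, Δ_πv⟫`
  field_simp
  ring

/-- ★★ **THE MEMBER TEXT OF lit `hasDerivAt_actionZ_chartRay_real`'s HYPOTHESIS `h79`** at `U₀ ∈ 𝔘_k(ε₀)` in the windows, with `P Y := IsLandauPrintS … U₀ (ιY) ∧ ∀ b, star (ιY b) = ιY b`,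
`Δ₁ := currentCLM … (DeltaOneJ … U₀)`, `Δπ := currentCLM … (DeltaPiSlot … U₀)`, `H := H1f …Δ_π… U₀`, `C := C̃`, `J := Jcur (bgOfCfg F K U₀)`.
[cite: Balaban1985Variational, (78)–(79) p.290, (76)–(77) p.289] -/
theorem h79_member_DeltaOnePJ (ha : 0 ≤ a) {ε₀ e : ℝ} (hε₀ : 0 < ε₀) (he : 0 < e) (hWe : 10 ^ 9 * (F.L : ℝ) ^ 2 * e ≤ 1) (hWε : 10 ^ 12 * (F.L : ℝ) ^ 3 * ε₀ ≤ 1)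
    (U₀ : GaugeField (F.P K) 0 (Matrix.specialUnitaryGroup (Fin 2) ℂ)) (hreg : RegPr F n K ε₀ U₀) :
    ∀ Y : Space115 (F.L : ℝ) (((F.L : ℝ)⁻¹) ^ (K - n)) (fun _ : Bond 3 (periodsT3 F K) => K - n) (fun _ : Bond 3 (periodsT3 F K) × Fin 3 => K - n)
        (nabla115 (((F.L : ℝ)⁻¹) ^ (K - n)) (bgOfCfg F K U₀)),
      (IsLandauPrintS F n K h c₀ cB U₀ (fun b : PBond (F.P K) 0 => JetSup.equiv _ _ _ Y (bondEquiv F K b))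
          ∧ ∀ b : PBond (F.P K) 0, star (JetSup.equiv _ _ _ Y (bondEquiv F K b)) = JetSup.equiv _ _ _ Y (bondEquiv F K b)) →
        pair27 (LinearMap.toContinuousLinearMap (Matrix.traceLinearMap (Fin 2) ℂ ℂ))
            (currentCLM frobEquiv (fun _ : Bond 3 (periodsT3 F K) × Fin 3 => K - n) (nabla115 (((F.L : ℝ)⁻¹) ^ (K - n)) (bgOfCfg F K U₀)) (DeltaOnePJ F n K h c₀ cB a U₀) Y)
            (flat115 Y)
          = pair27 (LinearMap.toContinuousLinearMap (Matrix.traceLinearMap (Fin 2) ℂ ℂ))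
              (currentCLM frobEquiv (fun _ : Bond 3 (periodsT3 F K) × Fin 3 => K - n) (nabla115 (((F.L : ℝ)⁻¹) ^ (K - n)) (bgOfCfg F K U₀)) (DeltaPiSlotP F n K h c₀ cB a U₀) Y)
              (flat115 Y)
            - 2 * pair27 (LinearMap.toContinuousLinearMap (Matrix.traceLinearMap (Fin 2) ℂ ℂ))
              (Jcur (bgOfCfg F K U₀) : NegSize (F.L : ℝ) (((F.L : ℝ)⁻¹) ^ (K - n)) (fun _ : Bond 3 (periodsT3 F K) => K - n) 3 (Matrix (Fin 2) (Fin 2) ℂ))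
              (flat115 (H1f F n K h c₀ cB a (DeltaPiSlotP F n K h c₀ cB a) U₀
                (quadPart (fun A' : Space115 (F.L : ℝ) (((F.L : ℝ)⁻¹) ^ (K - n)) (fun _ : Bond 3 (periodsT3 F K) => K - n)
                    (fun _ : Bond 3 (periodsT3 F K) × Fin 3 => K - n) (nabla115 (((F.L : ℝ)⁻¹) ^ (K - n)) (bgOfCfg F K U₀)) =>
                      (-Complex.I) • CmapTwS F n K h U₀ (((((eta F n K : ℝ) : ℂ)) * Complex.I) • fun b : PBond (F.P K) 0 => JetSup.equiv _ _ _ A' (bondEquiv F K b))) Y))) :=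
  fun Y hP => pair27_DeltaOnePJ_eq_of_landau ha hε₀ he hWe hWε U₀ hreg Y hP.2 hP.1

end Summit.QuantumFields.YangMills.Theorems.Prop7Row79AtMemberPInv

end
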